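import Mathlib.MeasureTheory.Integral.Prod
import Mathlib.Algebra.QuadraticDiscriminant
import Literature.MathematicalPhysics.KineticTheory.CollisionTubeFunctional
import Literature.MathematicalPhysics.KineticTheory.HardSphereEulerProofs
import Literature.MathematicalPhysics.KineticTheory.HardSphereBBGKYLiouvilleFlow
import HarnessLib

/-!
# `L² →` probability for the time-integrated tube statistic (`stub_l2ToProbability`, S5 of the
# crux line `equilibrium-rung-mean-variance`, `JParityClosure.OddContactSymmetry`,
# stmt-AtomisticToContinuum-13078)

A finite-`N` inequality of pure probability (no dynamics beyond joint measurability of the flow,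
no stationarity, no limit).  Let `P` be a probability measure, `μ` a finite measure of total mass
`V` (here: Lebesgue measure on `[0, τ]`, `V = τ`) and `Y : α × Ω → ℝ` a jointly measurable field,
bounded on `S × Ω` for a `μ`-conull set `S`.  With `e(t) = E_P Y_t`, `M = ∫ e dμ` and
`T(ω) = ∫ Y(t, ω) dμ(t)`:

* `T(ω) − M = ∫ (Y_t(ω) − e(t)) dμ(t)` pointwise, and by Cauchy–Schwarz in time
  `(T − M)² ≤ V ∫ (Y_t − e(t))² dμ(t)` (`sq_integral_le_measureReal_mul_integral_sq`);
* Tonelli: `E_P ∫ (Y_t − e(t))² dμ = ∫ Var_P(Y_t) dμ ≤ V ς` if `Var_P(Y_t) ≤ ς` on `S`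
  (`integral_sq_integral_le_of_sq_integral_le`);
* Markov on the square: `P(c ≤ |T − M|) ≤ V² ς / c²`
  (`measure_le_abs_integral_le_of_sq_integral_le`), and `{η < |T|} ⊆ {η − m ≤ |T − M|}` when
  `|M| ≤ m < η` (`measure_lt_abs_integral_le_of_variance_le`).

The registered stub `stub_l2ToProbability` is the hard-sphere instance:
`Ω = Config (N+1) (Fin 3) 𝕋³`, `P = localGibbsLaw …`, `Y(t, z) = A_t(good.piecewise Φ_t id z)` with
`A_t = tubeStat … t` (jointly measurable by `measurable_piecewise_flow_torus`), which agrees with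
`A_t(Φ_t z)` for `P`-a.e. `z` (`P ≪` Liouville and `HardSphereFlow.ae_mem_good`), so that the mean
hypothesis, the variance hypothesis and the event `{η < |tubeTimeStat … z|}` are unchanged
(`measure_lt_abs_setIntegral_flow_le`, stated for a general one-time functional `A`).

References: standard (Chebyshev–Markov and Cauchy–Schwarz); H. Spohn, *Large Scale Dynamics of
Interacting Particles* (1991), Part I §2 for the setting.
-/

noncomputable section

open MeasureTheory ProbabilityTheory Set
open scoped ENNReal

namespace Summit.AtomisticToContinuum.HydrodynamicLimit.Theorems

open Literature.Analysis.FluidPDE Literature.MathematicalPhysics.KineticTheory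

/-! ## Pure measure theory -/

section MeasureTheory

variable {α Ω : Type*} [MeasurableSpace α] [MeasurableSpace Ω]

/-- **Cauchy–Schwarz against the constant `1` on a finite measure space**:
`(∫ f dμ)² ≤ μ(univ) ∫ f² dμ` for `f` and `f²` integrable (via the discriminant of the nonnegative
quadratic `s ↦ ∫ (s + f)² dμ`). [folklore] -/
theorem sq_integral_le_measureReal_mul_integral_sq {μ : Measure α} [IsFiniteMeasure μ]
    {f : α → ℝ} (hf : Integrable f μ) (hf2 : Integrable (fun x => f x ^ 2) μ) :
    (∫ x, f x ∂μ) ^ 2 ≤ μ.real univ * ∫ x, f x ^ 2 ∂μ := by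
  have hq : ∀ s : ℝ, 0 ≤ μ.real univ * (s * s) + (2 * ∫ x, f x ∂μ) * s + ∫ x, f x ^ 2 ∂μ := by
    intro s
    have i1 : Integrable (fun x => s * s + 2 * s * f x) μ :=
      (integrable_const _).add (hf.const_mul _)
    have i2 : Integrable (fun x => 2 * s * f x) μ := hf.const_mul _
    have h : μ.real univ * (s * s) + (2 * ∫ x, f x ∂μ) * s + ∫ x, f x ^ 2 ∂μ =
        ∫ x, (s + f x) ^ 2 ∂μ := by
      have h1 : (fun x => (s + f x) ^ 2) = fun x => s * s + 2 * s * f x + f x ^ 2 := by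
        funext x; ring
      rw [h1, integral_add i1 hf2, integral_add (integrable_const _) i2, integral_const,
        integral_const_mul, smul_eq_mul]
      ring
    rw [h]
    exact integral_nonneg fun x => sq_nonneg _
  have hd := discrim_le_zero hq
  rw [discrim] at hd
  nlinarith [hd]

/-- **Cauchy–Schwarz in time plus Tonelli.** For a finite measure `μ`, a probability measure `P`,
a `μ`-conull set `S` and a jointly measurable `G : α × Ω → ℝ` with `|G| ≤ C` on `S × Ω` and
`∫ G(t, ·)² dP ≤ ς` for `t ∈ S`: the random variable `ω ↦ (∫ G(t, ω) dμ(t))²` is `P`-integrable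
and `E_P (∫ G(t, ·) dμ(t))² ≤ μ(univ) · (μ(univ) · ς)`. [folklore] -/
theorem integral_sq_integral_le_of_sq_integral_le (μ : Measure α) [IsFiniteMeasure μ]
    (P : Measure Ω) [IsProbabilityMeasure P] {S : Set α} (hS : ∀ᵐ t ∂μ, t ∈ S)
    {G : α × Ω → ℝ} (hG : Measurable G) {C ς : ℝ} (hC : ∀ t ∈ S, ∀ ω, |G (t, ω)| ≤ C)
    (hvar : ∀ t ∈ S, ∫ ω, G (t, ω) ^ 2 ∂P ≤ ς) :
    Integrable (fun ω => (∫ t, G (t, ω) ∂μ) ^ 2) P ∧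
      ∫ ω, (∫ t, G (t, ω) ∂μ) ^ 2 ∂P ≤ μ.real univ * (μ.real univ * ς) := by
  have hGt : ∀ ω, Measurable fun t => G (t, ω) := fun ω => hG.comp measurable_prodMk_right
  -- `G²` is integrable on the product
  have hprod : ∀ᵐ p ∂(μ.prod P), p.1 ∈ S := Measure.quasiMeasurePreserving_fst.ae hS
  have hG2int : Integrable (fun p : α × Ω => G p ^ 2) (μ.prod P) := by
    refine Integrable.of_bound (hG.pow_const 2).aestronglyMeasurable (C ^ 2) ?_
    filter_upwards [hprod] with p hp
    rw [Real.norm_of_nonneg (sq_nonneg _), ← sq_abs]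
    exact pow_le_pow_left₀ (abs_nonneg _) (hC p.1 hp p.2) 2
  -- sections in time are integrable
  have hGint : ∀ ω, Integrable (fun t => G (t, ω)) μ := fun ω =>
    Integrable.of_bound (hGt ω).aestronglyMeasurable C (hS.mono fun t ht => by
      rw [Real.norm_eq_abs]; exact hC t ht ω)
  have hG2int' : ∀ ω, Integrable (fun t => G (t, ω) ^ 2) μ := fun ω =>
    Integrable.of_bound ((hGt ω).pow_const 2).aestronglyMeasurable (C ^ 2)
      (hS.mono fun t ht => by
        rw [Real.norm_of_nonneg (sq_nonneg _), ← sq_abs]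
        exact pow_le_pow_left₀ (abs_nonneg _) (hC t ht ω) 2)
  -- pointwise Cauchy–Schwarz in time
  have hCS : ∀ ω, (∫ t, G (t, ω) ∂μ) ^ 2 ≤ μ.real univ * ∫ t, G (t, ω) ^ 2 ∂μ := fun ω =>
    sq_integral_le_measureReal_mul_integral_sq (hGint ω) (hG2int' ω)
  -- integrability in `ω`
  have hI2 : Integrable (fun ω => ∫ t, G (t, ω) ^ 2 ∂μ) P := hG2int.integral_prod_right
  have hTmeas : StronglyMeasurable fun ω => ∫ t, G (t, ω) ∂μ :=
    hG.stronglyMeasurable.integral_prod_left'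
  have hTbd : ∀ ω, |∫ t, G (t, ω) ∂μ| ≤ C * μ.real univ := fun ω => by
    have h := norm_integral_le_of_norm_le_const (μ := μ) (f := fun t => G (t, ω)) (C := C)
      (hS.mono fun t ht => by rw [Real.norm_eq_abs]; exact hC t ht ω)
    rwa [Real.norm_eq_abs] at h
  have hI1 : Integrable (fun ω => (∫ t, G (t, ω) ∂μ) ^ 2) P :=
    Integrable.of_bound (hTmeas.measurable.pow_const 2).aestronglyMeasurable
      ((C * μ.real univ) ^ 2) (ae_of_all _ fun ω => by
        rw [Real.norm_of_nonneg (sq_nonneg _), ← sq_abs]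
        exact pow_le_pow_left₀ (abs_nonneg _) (hTbd ω) 2)
  refine ⟨hI1, ?_⟩
  have hswap : ∫ ω, ∫ t, G (t, ω) ^ 2 ∂μ ∂P = ∫ t, ∫ ω, G (t, ω) ^ 2 ∂P ∂μ :=
    (integral_integral_swap (f := fun t ω => G (t, ω) ^ 2) hG2int).symm
  have hV : 0 ≤ μ.real univ := measureReal_nonneg
  calc ∫ ω, (∫ t, G (t, ω) ∂μ) ^ 2 ∂P
      ≤ ∫ ω, μ.real univ * ∫ t, G (t, ω) ^ 2 ∂μ ∂P := integral_mono hI1 (hI2.const_mul _) hCS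
    _ = μ.real univ * ∫ t, ∫ ω, G (t, ω) ^ 2 ∂P ∂μ := by rw [integral_const_mul, hswap]
    _ ≤ μ.real univ * (μ.real univ * ς) := by
        refine mul_le_mul_of_nonneg_left ?_ hV
        calc ∫ t, ∫ ω, G (t, ω) ^ 2 ∂P ∂μ ≤ ∫ _t, ς ∂μ :=
              integral_mono_of_nonneg (ae_of_all _ fun t => integral_nonneg fun ω => sq_nonneg _)
                (integrable_const ς) (hS.mono fun t ht => hvar t ht)
          _ = μ.real univ * ς := by rw [integral_const, smul_eq_mul]

/-- **Markov on the square.** Under the hypotheses of `integral_sq_integral_le_of_sq_integral_le`,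
`P {c ≤ |∫ G(t, ·) dμ(t)|} ≤ μ(univ)² ς / c²` for `c > 0`. [folklore] -/
theorem measure_le_abs_integral_le_of_sq_integral_le (μ : Measure α) [IsFiniteMeasure μ]
    (P : Measure Ω) [IsProbabilityMeasure P] {S : Set α} (hS : ∀ᵐ t ∂μ, t ∈ S)
    {G : α × Ω → ℝ} (hG : Measurable G) {C ς c : ℝ} (hc : 0 < c)
    (hC : ∀ t ∈ S, ∀ ω, |G (t, ω)| ≤ C) (hvar : ∀ t ∈ S, ∫ ω, G (t, ω) ^ 2 ∂P ≤ ς) :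
    P {ω | c ≤ |∫ t, G (t, ω) ∂μ|} ≤ ENNReal.ofReal (μ.real univ ^ 2 * ς / c ^ 2) := by
  obtain ⟨hI1, hle⟩ := integral_sq_integral_le_of_sq_integral_le μ P hS hG hC hvar
  have hmarkov := mul_meas_ge_le_integral_of_nonneg (ae_of_all _ fun ω => sq_nonneg _) hI1 (c ^ 2)
  have hset : {ω | c ≤ |∫ t, G (t, ω) ∂μ|} = {ω | c ^ 2 ≤ (∫ t, G (t, ω) ∂μ) ^ 2} := by
    ext ω
    simp only [mem_setOf_eq]
    rw [← sq_abs (∫ t, G (t, ω) ∂μ)]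
    exact (pow_le_pow_iff_left₀ hc.le (abs_nonneg _) two_ne_zero).symm
  rw [hset]
  have hreal : P.real {ω | c ^ 2 ≤ (∫ t, G (t, ω) ∂μ) ^ 2} ≤ μ.real univ ^ 2 * ς / c ^ 2 := by
    rw [le_div_iff₀ (pow_pos hc 2), mul_comm]
    calc c ^ 2 * P.real {ω | c ^ 2 ≤ (∫ t, G (t, ω) ∂μ) ^ 2}
        ≤ ∫ ω, (∫ t, G (t, ω) ∂μ) ^ 2 ∂P := hmarkov
      _ ≤ μ.real univ * (μ.real univ * ς) := hle
      _ = μ.real univ ^ 2 * ς := by ring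
  rw [← ofReal_measureReal (measure_ne_top P _)]
  exact ENNReal.ofReal_le_ofReal hreal

/-- **`L² →` probability, abstract form.** For a finite measure `μ` (mass `V`), a probability
measure `P`, a `μ`-conull set `S`, a jointly measurable field `Y : α × Ω → ℝ` bounded on `S × Ω`,
with time-integrated mean `|∫ E_P Y_t dμ(t)| ≤ m < η` and variances `Var_P(Y_t) ≤ ς` on `S`:
`P {η < |∫ Y(t, ·) dμ(t)|} ≤ V² ς / (η − m)²`. [folklore] -/
theorem measure_lt_abs_integral_le_of_variance_le (μ : Measure α) [IsFiniteMeasure μ]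
    (P : Measure Ω) [IsProbabilityMeasure P] {S : Set α} (hS : ∀ᵐ t ∂μ, t ∈ S)
    {Y : α × Ω → ℝ} (hY : Measurable Y) {B m ς η : ℝ} (hB : ∀ t ∈ S, ∀ ω, |Y (t, ω)| ≤ B)
    (hmean : |∫ t, ∫ ω, Y (t, ω) ∂P ∂μ| ≤ m) (hmη : m < η)
    (hvar : ∀ t ∈ S, variance (fun ω => Y (t, ω)) P ≤ ς) :
    P {ω | η < |∫ t, Y (t, ω) ∂μ|} ≤ ENNReal.ofReal (μ.real univ ^ 2 * ς / (η - m) ^ 2) := by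
  -- the mean `e t = E_P Y_t`, kept opaque
  obtain ⟨e, he⟩ : ∃ e : α → ℝ, ∀ t, e t = ∫ ω, Y (t, ω) ∂P := ⟨_, fun _ => rfl⟩
  have he_fun : e = fun t => ∫ ω, Y (t, ω) ∂P := funext he
  have he_meas : Measurable e := by
    rw [he_fun]
    exact (hY.stronglyMeasurable.integral_prod_right' (ν := P)).measurable
  have he_bd : ∀ t ∈ S, |e t| ≤ B := fun t ht => by
    rw [he]
    have h := norm_integral_le_of_norm_le_const (μ := P) (f := fun ω => Y (t, ω)) (C := B)
      (ae_of_all P fun ω => by rw [Real.norm_eq_abs]; exact hB t ht ω)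
    rwa [Real.norm_eq_abs, probReal_univ, mul_one] at h
  -- the centred field `G = Y - e`
  have hG : Measurable fun p : α × Ω => Y p - e p.1 := hY.sub (he_meas.comp measurable_fst)
  have hGC : ∀ t ∈ S, ∀ ω, |(fun p : α × Ω => Y p - e p.1) (t, ω)| ≤ B + B := by
    intro t ht ω
    have h1 := abs_le.1 (hB t ht ω)
    have h2 := abs_le.1 (he_bd t ht)
    exact abs_le.2 ⟨by dsimp only; linarith, by dsimp only; linarith⟩
  have hGvar : ∀ t ∈ S, ∫ ω, (fun p : α × Ω => Y p - e p.1) (t, ω) ^ 2 ∂P ≤ ς := by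
    intro t ht
    have h := hvar t ht
    have hX : AEMeasurable (fun ω => Y (t, ω)) P := (hY.comp measurable_prodMk_left).aemeasurable
    rw [variance_eq_integral hX] at h
    simpa only [he] using h
  -- `∫ G(t, ω) dμ(t) = T ω - M`
  have he_int : Integrable e μ :=
    Integrable.of_bound he_meas.aestronglyMeasurable B (hS.mono fun t ht => by
      rw [Real.norm_eq_abs]; exact he_bd t ht)
  have hYint : ∀ ω, Integrable (fun t => Y (t, ω)) μ := fun ω =>
    Integrable.of_bound (hY.comp measurable_prodMk_right).aestronglyMeasurable B
      (hS.mono fun t ht => by rw [Real.norm_eq_abs]; exact hB t ht ω)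
  have hGT : ∀ ω, ∫ t, (fun p : α × Ω => Y p - e p.1) (t, ω) ∂μ =
      (∫ t, Y (t, ω) ∂μ) - ∫ t, e t ∂μ := fun ω => integral_sub (hYint ω) he_int
  have hMm : |∫ t, e t ∂μ| ≤ m := by simpa only [he] using hmean
  -- inclusion of events and the Markov bound
  have hsub : {ω | η < |∫ t, Y (t, ω) ∂μ|} ⊆
      {ω | η - m ≤ |∫ t, (fun p : α × Ω => Y p - e p.1) (t, ω) ∂μ|} := by
    intro ω hω
    simp only [mem_setOf_eq] at hω ⊢
    rw [hGT ω]
    have := abs_sub_abs_le_abs_sub (∫ t, Y (t, ω) ∂μ) (∫ t, e t ∂μ)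
    linarith
  exact (measure_mono hsub).trans
    (measure_le_abs_integral_le_of_sq_integral_le μ P hS hG (sub_pos.2 hmη) hGC hGvar)

end MeasureTheory

/-! ## The hard-sphere instance -/

open scoped Classical in
/-- **`L² →` probability along a hard-sphere flow**, for a general one-time functional `A`.
If `P = localGibbsLaw σ a₀ u₀ θ₀ N Φ` is a probability measure, `(t, z) ↦ A t z` is jointly
measurable with `|A t z| ≤ B` on `[0, τ] × Config`, `|∫₀^τ E_P[A_t ∘ Φ_t] dt| ≤ m < η` and
`Var_P(A_t ∘ Φ_t) ≤ ς` for `t ∈ [0, τ]`, then `P {η < |∫₀^τ A_t(Φ_t z) dt|} ≤ τ²ς/(η − m)²`.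
Proof: `measure_lt_abs_integral_le_of_variance_le` for Lebesgue measure on `[0, τ]` and the
jointly measurable field `Y(t, z) = A_t(good.piecewise Φ_t id z)`
(`measurable_piecewise_flow_torus`), which agrees with `A_t(Φ_t z)` for `P`-a.e. `z`
(`localGibbsLaw_eq`, `localGibbsMeasure_absolutelyContinuous`, `HardSphereFlow.ae_mem_good`,
`piecewise_flow_of_mem`), so that the mean hypothesis, the variance hypothesis and the event
are unchanged. [folklore] -/
theorem measure_lt_abs_setIntegral_flow_le (σ : ℝ) (a₀ θ₀ : T3 → ℝ) (u₀ : T3 → V3) (N : ℕ)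
    (Φ : HardSphereFlow (Torus.geometry (Fin 3)) (hsDiameter σ N) (N + 1))
    [IsProbabilityMeasure (localGibbsLaw σ a₀ u₀ θ₀ N Φ)]
    {A : ℝ → Config (N + 1) (Fin 3) T3 → ℝ} {τ m ς η B : ℝ}
    (hmeas : Measurable fun p : ℝ × Config (N + 1) (Fin 3) T3 => A p.1 p.2)
    (hB : ∀ t ∈ Icc (0 : ℝ) τ, ∀ z : Config (N + 1) (Fin 3) T3, |A t z| ≤ B) (hτ : 0 < τ)
    (hmη : m < η)
    (hmean : |∫ t in Icc (0 : ℝ) τ, ∫ z, A t (Φ.flow t z) ∂(localGibbsLaw σ a₀ u₀ θ₀ N Φ)| ≤ m)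
    (hvar : ∀ t ∈ Icc (0 : ℝ) τ,
      variance (fun z => A t (Φ.flow t z)) (localGibbsLaw σ a₀ u₀ θ₀ N Φ) ≤ ς) :
    localGibbsLaw σ a₀ u₀ θ₀ N Φ {z | η < |∫ t in Icc (0 : ℝ) τ, A t (Φ.flow t z)|}
      ≤ ENNReal.ofReal (τ ^ 2 * ς / (η - m) ^ 2) := by
  -- `P`-a.e. configuration is good
  have hgood : ∀ᵐ z ∂(localGibbsLaw σ a₀ u₀ θ₀ N Φ), z ∈ Φ.good := by
    rw [localGibbsLaw_eq]
    exact (localGibbsMeasure_absolutelyContinuous σ a₀ u₀ θ₀ N Φ).ae_le Φ.ae_mem_good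
  -- the globally defined, jointly measurable evaluation of `A_t` along the flow
  have hY : Measurable fun p : ℝ × Config (N + 1) (Fin 3) T3 =>
      A p.1 (Φ.good.piecewise (Φ.flow p.1) id p.2) :=
    hmeas.comp (measurable_fst.prodMk (measurable_piecewise_flow_torus Φ))
  have hYeq : ∀ z ∈ Φ.good, ∀ t, A t (Φ.good.piecewise (Φ.flow t) id z) = A t (Φ.flow t z) :=
    fun z hz t => by rw [piecewise_flow_of_mem Φ t hz]
  have hYae : ∀ t, (fun z => A t (Φ.good.piecewise (Φ.flow t) id z))
      =ᵐ[localGibbsLaw σ a₀ u₀ θ₀ N Φ] fun z => A t (Φ.flow t z) :=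
    fun t => hgood.mono fun z hz => hYeq z hz t
  have hYB : ∀ t ∈ Icc (0 : ℝ) τ, ∀ z : Config (N + 1) (Fin 3) T3,
      |(fun p : ℝ × Config (N + 1) (Fin 3) T3 =>
        A p.1 (Φ.good.piecewise (Φ.flow p.1) id p.2)) (t, z)| ≤ B :=
    fun t ht z => hB t ht _
  -- transfer of the mean and variance hypotheses
  have hmean' : |∫ t in Icc (0 : ℝ) τ, ∫ z, (fun p : ℝ × Config (N + 1) (Fin 3) T3 =>
      A p.1 (Φ.good.piecewise (Φ.flow p.1) id p.2)) (t, z)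
        ∂(localGibbsLaw σ a₀ u₀ θ₀ N Φ)| ≤ m := by
    have h : ∫ t in Icc (0 : ℝ) τ, ∫ z, (fun p : ℝ × Config (N + 1) (Fin 3) T3 =>
          A p.1 (Φ.good.piecewise (Φ.flow p.1) id p.2)) (t, z)
            ∂(localGibbsLaw σ a₀ u₀ θ₀ N Φ) =
        ∫ t in Icc (0 : ℝ) τ, ∫ z, A t (Φ.flow t z) ∂(localGibbsLaw σ a₀ u₀ θ₀ N Φ) :=
      integral_congr_ae (ae_of_all _ fun t => integral_congr_ae (hYae t))
    rw [h]
    exact hmean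
  have hvar' : ∀ t ∈ Icc (0 : ℝ) τ, variance (fun z => (fun p : ℝ × Config (N + 1) (Fin 3) T3 =>
      A p.1 (Φ.good.piecewise (Φ.flow p.1) id p.2)) (t, z)) (localGibbsLaw σ a₀ u₀ θ₀ N Φ) ≤ ς :=
    fun t ht => (variance_congr (hYae t)).trans_le (hvar t ht)
  -- Lebesgue measure on `[0, τ]`
  have hS : ∀ᵐ t ∂(volume.restrict (Icc (0 : ℝ) τ)), t ∈ Icc (0 : ℝ) τ :=
    ae_restrict_mem measurableSet_Icc
  have hmass : (volume.restrict (Icc (0 : ℝ) τ)).real univ = τ := by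
    rw [measureReal_restrict_apply_univ, Real.volume_real_Icc, sub_zero, max_eq_left hτ.le]
  have key := measure_lt_abs_integral_le_of_variance_le (volume.restrict (Icc (0 : ℝ) τ))
    (localGibbsLaw σ a₀ u₀ θ₀ N Φ) hS hY hYB hmean' hmη hvar'
  rw [hmass] at key
  refine le_trans (measure_mono_ae ?_) key
  filter_upwards [hgood] with z hz h
  have hT : ∫ t in Icc (0 : ℝ) τ, A t (Φ.flow t z) = ∫ t in Icc (0 : ℝ) τ,
      (fun p : ℝ × Config (N + 1) (Fin 3) T3 =>
        A p.1 (Φ.good.piecewise (Φ.flow p.1) id p.2)) (t, z) :=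
    integral_congr_ae (ae_of_all _ fun t => (hYeq z hz t).symm)
  show η < |∫ t in Icc (0 : ℝ) τ, (fun p : ℝ × Config (N + 1) (Fin 3) T3 =>
      A p.1 (Φ.good.piecewise (Φ.flow p.1) id p.2)) (t, z)|
  rw [← hT]
  exact h

/-- **S5 · `L² →` probability** (registered stub `stub_l2ToProbability` of the line
`equilibrium-rung-mean-variance`).  For every `σ`, profiles, `N`, flow `Φ`, `τ > 0`, marks,
`r, ϑ, L, κ`, `ς ≥ 0`, `m < η` and bound `B`: if `P = localGibbsLaw …` is a probability measure,
`(t, z) ↦ A_t(z) = tubeStat … t z` is jointly measurable with `|A_t(z)| ≤ B` on `[0, τ] × Config`,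
the time-integrated mean of `A_t ∘ Φ_t` under `P` has modulus `≤ m` and `Var_P(A_t ∘ Φ_t) ≤ ς`
for every `t ∈ [0, τ]`, then `P(η < |T_{L,κ}|) ≤ τ²ς/(η − m)²`, `T_{L,κ} = tubeTimeStat …`
(`tubeTimeStat_def`): the instance `A = tubeStat σ N χ g Ψ r ϑ L κ` of
`measure_lt_abs_setIntegral_flow_le`. [folklore] -/
theorem stub_l2ToProbability :
    ∀ (σ : ℝ) (a₀ θ₀ : T3 → ℝ) (u₀ : T3 → V3) (N : ℕ)
      (Φ : HardSphereFlow (Torus.geometry (Fin 3)) (hsDiameter σ N) (N + 1))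
      (τ : ℝ) (χ : ℝ × UnitAddTorus (Fin 3) → ℝ) (g : ℝ → ℝ)
      (Ψ : EuclideanSpace ℝ (Fin 3) × EuclideanSpace ℝ (Fin 3) × EuclideanSpace ℝ (Fin 3) → ℝ)
      (r ϑ L κ m ς η B : ℝ),
      IsProbabilityMeasure (localGibbsLaw σ a₀ u₀ θ₀ N Φ) →
      Measurable (fun p : ℝ × Config (N + 1) (Fin 3) T3 => tubeStat σ N χ g Ψ r ϑ L κ p.1 p.2) →
      (∀ t ∈ Set.Icc (0 : ℝ) τ, ∀ z : Config (N + 1) (Fin 3) T3, |tubeStat σ N χ g Ψ r ϑ L κ t z| ≤ B) →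
      0 < τ → 0 ≤ ς → m < η →
      |∫ t in Set.Icc (0 : ℝ) τ,
          ∫ z, tubeStat σ N χ g Ψ r ϑ L κ t (Φ.flow t z) ∂(localGibbsLaw σ a₀ u₀ θ₀ N Φ)| ≤ m →
      (∀ t ∈ Set.Icc (0 : ℝ) τ,
        ProbabilityTheory.variance (fun z => tubeStat σ N χ g Ψ r ϑ L κ t (Φ.flow t z))
          (localGibbsLaw σ a₀ u₀ θ₀ N Φ) ≤ ς) →
      localGibbsLaw σ a₀ u₀ θ₀ N Φ {z | η < |tubeTimeStat σ N Φ τ χ g Ψ r ϑ L κ z|}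
        ≤ ENNReal.ofReal (τ ^ 2 * ς / (η - m) ^ 2) := by
  intro σ a₀ θ₀ u₀ N Φ τ χ g Ψ r ϑ L κ m ς η B hP hmeas hB hτ _hς hmη hmean hvar
  exact measure_lt_abs_setIntegral_flow_le σ a₀ θ₀ u₀ N Φ hmeas hB hτ hmη hmean hvar

end Summit.AtomisticToContinuum.HydrodynamicLimit.Theorems
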